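import Mathlib

/-!
# Hodge-locus census — arithmetic side facts of LEMMA G2 / LEMMA G3 (COROLLARY D3″, cubic cells)

certified instances and evidence bearing on the general Hodge conjecture; no claim.

pub-hlocus ENGINE B, gen 32, record `ENGINEB-g32.md` §13b.  In the cubic cell `(2k′, 3, k′−1)` the values
`b = 2` and `b = 1` are realised by explicit members `A2_{k′}`, `A3_{k′}` which are Thom–Sebastiani sums of
binary cubics `y (x² + y²)` with an 8-variable block `G2` resp. a 12-variable block `G3`.  The hand proofs that
`G2` and `G3` are smooth (LEMMA G2, LEMMA G3 of the record) split on `ab = 0` / `ab ≠ 0` and end in finite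
facts.  This file certifies those terminal facts, in the generality of an arbitrary field of characteristic 0:

* `g2_branch1` : the `ab = 0, y₃ ≠ 0` system of `G2` forces `y₃ = 0` (so it has no solution);
* `g2_branch2` : the `ab ≠ 0` system of `G2` (after the forced normalisation `a = b = 1, x₃ = −3,
  y₃ = 1/6`, i.e. `x₁ x₂ = −109/12`) is inconsistent;
* `g3_branch1_Z4`, `g3_branch2_Z4` : in the two branches of `G3` the quantity `Z⁴ := s⁴ / T`
  (`s = x₂ + x₄ + x₅`, `T` the common value of `x_j⁴`) equals `16`, resp. `190096 = 16 · 109²`;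
* `sum3_parity`, `sum3_normSq_le`, `no_Z4_eq_16`, `no_Z4_eq_190096` : for `Z` a sum of three fourth roots of
  unity in `ℤ[i]` (modelled on `ℤ × ℤ` with the Gaussian product `gmul`), `Re Z + Im Z` is odd,
  `|Z|² ≤ 9`, and `Z⁴ ∉ {16, 190096}` — which contradicts the two branch values, so `G3` is smooth.

Only integer / field identities are certified here; the eliminations leading to the hypotheses of the four
field lemmas are displayed in the record (§13b) and are what a reader checks by hand.
-/

namespace Summit.HodgeConjecture.HodgeConjecture.HodgeLocus.Census.D3

section FieldFacts

variable {K : Type*} [Field K] [CharZero K]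

/-- LEMMA G2, branch `ab = 0`, sub-case `y₃ ≠ 0` (then `a = b = x₃ = 0`): the remaining equations
`x₁x₂ = −3y₃²`, `2x₁y₁ = −y₃x₂`, `2x₂y₂ = −y₃x₁`, `x₁² = −3y₁²`, `x₂² = −3y₂²` force `y₃ = 0`. -/
theorem g2_branch1 (x₁ x₂ y₁ y₂ y₃ : K)
    (h0 : x₁ * x₂ = -3 * y₃ ^ 2) (h1 : 2 * x₁ * y₁ = -y₃ * x₂) (h2 : 2 * x₂ * y₂ = -y₃ * x₁)
    (h3 : x₁ ^ 2 = -3 * y₁ ^ 2) (h4 : x₂ ^ 2 = -3 * y₂ ^ 2) : y₃ = 0 := by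
  by_contra hy
  -- (2x₁y₁)(2x₂y₂) = y₃² x₁x₂ together with x₁x₂ = -3y₃² :  y₃² (4 y₁ y₂ - y₃²) = 0
  have e1 : y₃ ^ 2 * (4 * y₁ * y₂ - y₃ ^ 2) = 0 := by
    linear_combination (-(2 * x₂ * y₂) / 3) * h1 + (y₃ * x₂ / 3) * h2 + ((4 * y₁ * y₂ - y₃ ^ 2) / 3) * h0
  -- x₁² x₂² = 9 y₁² y₂²  and  (x₁x₂)² = 9 y₃⁴ :  y₁² y₂² = y₃⁴
  have e2 : y₁ ^ 2 * y₂ ^ 2 = y₃ ^ 4 := by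
    linear_combination ((x₁ * x₂ - 3 * y₃ ^ 2) / 9) * h0 - (x₂ ^ 2 / 9) * h3 + (y₁ ^ 2 / 3) * h4
  have hy2 : y₃ ^ 2 ≠ 0 := pow_ne_zero 2 hy
  have h : 4 * y₁ * y₂ = y₃ ^ 2 := by
    have := (mul_eq_zero.mp e1).resolve_left hy2
    exact (sub_eq_zero.mp this)
  have e3 : (15 : K) * y₃ ^ 4 = 0 := by
    linear_combination (4 * y₁ * y₂ + y₃ ^ 2) * h - 16 * e2
  have : y₃ ^ 4 = 0 := (mul_eq_zero.mp e3).resolve_left (by norm_num)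
  exact hy (pow_eq_zero_iff (by norm_num) |>.mp this)

/-- LEMMA G2, branch `ab ≠ 0` (normalised `a = b = 1`, `x₃ = −3`, `y₃ = 1/6`): the equations
`48x₁⁴ = −x₂²`, `48x₂⁴ = −x₁²` give `2304 (x₁x₂)⁴ = (x₁x₂)²`, incompatible with `x₁x₂ = −109/12`. -/
theorem g2_branch2 (x₁ x₂ : K) (h1 : 48 * x₁ ^ 4 = -x₂ ^ 2) (h2 : 48 * x₂ ^ 4 = -x₁ ^ 2)
    (hc : x₁ * x₂ = -109 / 12) : False := by
  have key : 2304 * (x₁ * x₂) ^ 4 = (x₁ * x₂) ^ 2 := by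
    linear_combination (48 * x₂ ^ 4) * h1 - x₂ ^ 2 * h2
  rw [hc] at key
  norm_num at key

/-- LEMMA G3, branch `ab = 0` (`a = b = x₃ = 0`, `y₃ ≠ 0`, `x₁ ≠ 0`): with `s = x₂+x₄+x₅`,
`x₁ s = −3y₃²`, the common value `T` of `x_j⁴` satisfying `4T = −3y₃²x₁²`, and `4x₁⁶ = −27y₃⁶`,
the ratio `Z4 := s⁴/T` (here introduced through `Z4 · (−3y₃²x₁²) = 4 s⁴`) equals `16`. -/
theorem g3_branch1_Z4 (x y₃ s Z4 : K) (hx : x ≠ 0) (hy : y₃ ≠ 0)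
    (hs : x * s = -3 * y₃ ^ 2) (hZ : Z4 * (-3 * y₃ ^ 2 * x ^ 2) = 4 * s ^ 4)
    (h6 : 4 * x ^ 6 = -27 * y₃ ^ 6) : Z4 = 16 := by
  have e1 : y₃ ^ 2 * (3 * Z4 * x ^ 6 + 324 * y₃ ^ 6) = 0 := by
    linear_combination (-x ^ 4) * hZ + (-4 * (x * s - 3 * y₃ ^ 2) * (x ^ 2 * s ^ 2 + 9 * y₃ ^ 4)) * hs
  have h' : 3 * Z4 * x ^ 6 + 324 * y₃ ^ 6 = 0 :=
    (mul_eq_zero.mp e1).resolve_left (pow_ne_zero 2 hy)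
  have e2 : (3 * x ^ 6) * (Z4 - 16) = 0 := by
    linear_combination h' - 12 * h6
  have hx6 : (3 : K) * x ^ 6 ≠ 0 := mul_ne_zero (by norm_num) (pow_ne_zero 6 hx)
  exact sub_eq_zero.mp ((mul_eq_zero.mp e2).resolve_left hx6)

/-- LEMMA G3, branch `ab ≠ 0` (`a = b = 1`, `x₃ = −3`, `y₃ = 1/6`): with `12 x₁ s = −109`,
`48x₁⁴ = −s²`, the common value `T′ = −x₁²/48` of `x_j⁴`, the ratio `Z4 := s⁴/T′`
(introduced through `Z4 · x₁² = −48 s⁴`) equals `190096 = 16 · 109²`. -/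
theorem g3_branch2_Z4 (x s Z4 : K) (hs : 12 * x * s = -109) (h1 : 48 * x ^ 4 = -s ^ 2)
    (hZ : Z4 * x ^ 2 = -48 * s ^ 4) : Z4 = 190096 := by
  have hx : x ≠ 0 := by
    rintro rfl
    norm_num at hs
  have e1 : 6912 * x ^ 6 = -(109 : K) ^ 2 := by
    linear_combination (-(12 * x * s - 109)) * hs + (144 * x ^ 2) * h1
  have e2 : x ^ 2 * (Z4 - 190096) = 0 := by
    linear_combination hZ + (-48 * s ^ 2 + 2304 * x ^ 4) * h1 + (-16 * x ^ 2) * e1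
  exact sub_eq_zero.mp ((mul_eq_zero.mp e2).resolve_left (pow_ne_zero 2 hx))

/-- `190096 = 16 · 109² = 436²`. -/
theorem val_190096 : (190096 : ℕ) = 16 * 109 ^ 2 ∧ (190096 : ℕ) = 436 ^ 2 := by norm_num

end FieldFacts

section GaussianFacts

/-- The four fourth roots of unity `1, −1, i, −i` of `ℤ[i]`, as pairs `(Re, Im)`. -/
def U4 : List (ℤ × ℤ) := [(1, 0), (-1, 0), (0, 1), (0, -1)]

/-- Gaussian product on `ℤ × ℤ`: `(a + bi)(c + di) = (ac − bd) + (ad + bc) i`. -/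
def gmul (z w : ℤ × ℤ) : ℤ × ℤ := (z.1 * w.1 - z.2 * w.2, z.1 * w.2 + z.2 * w.1)

/-- Sum of three Gaussian integers. -/
def gadd3 (u v w : ℤ × ℤ) : ℤ × ℤ := (u.1 + v.1 + w.1, u.2 + v.2 + w.2)

/-- Fourth power for the Gaussian product. -/
def gpow4 (z : ℤ × ℤ) : ℤ × ℤ := gmul (gmul z z) (gmul z z)

/-- `gmul` is the multiplication of `ℤ[i]`: it matches `GaussianInt` multiplication coordinatewise. -/
theorem gmul_eq (z w : GaussianInt) :
    gmul (z.re, z.im) (w.re, w.im) = ((z * w).re, (z * w).im) := by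
  refine Prod.ext ?_ ?_
  · simp [gmul, Zsqrtd.re_mul]
    ring
  · simp [gmul, Zsqrtd.im_mul]

/-- A sum `Z` of three fourth roots of unity has `Re Z + Im Z` odd (so `Z ∉ {±2, ±2i}`). -/
theorem sum3_parity : ∀ u ∈ U4, ∀ v ∈ U4, ∀ w ∈ U4, ((gadd3 u v w).1 + (gadd3 u v w).2) % 2 = 1 := by
  decide

/-- … and `|Z|² ≤ 9` (so `Z⁴ = 190096`, which needs `|Z|² = 436`, is impossible). -/
theorem sum3_normSq_le : ∀ u ∈ U4, ∀ v ∈ U4, ∀ w ∈ U4,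
    (gadd3 u v w).1 ^ 2 + (gadd3 u v w).2 ^ 2 ≤ 9 := by
  decide

/-- No sum of three fourth roots of unity has `Z⁴ = 16` (LEMMA G3, branch `ab = 0`). -/
theorem no_Z4_eq_16 : ∀ u ∈ U4, ∀ v ∈ U4, ∀ w ∈ U4, gpow4 (gadd3 u v w) ≠ (16, 0) := by
  decide

/-- No sum of three fourth roots of unity has `Z⁴ = 190096` (LEMMA G3, branch `ab ≠ 0`). -/
theorem no_Z4_eq_190096 : ∀ u ∈ U4, ∀ v ∈ U4, ∀ w ∈ U4, gpow4 (gadd3 u v w) ≠ (190096, 0) := by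
  decide

end GaussianFacts

end Summit.HodgeConjecture.HodgeConjecture.HodgeLocus.Census.D3
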